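import Literature.NumberTheory.EllipticCurves.ComplexMultiplicationPeriodLatticeCMProofs
import Literature.NumberTheory.EllipticCurves.ComplexMultiplicationSingularModuliProofs
import HarnessLib

/-!
# Coates–Wiles for geometric CM (`finite_point_of_hasCM_of_L_one_ne_zero`): three leaves remain

Topic `NumberTheory/EllipticCurves`; a proofs-only assembly file (theorems only, no definitions,
no named facts) for the named fact
`Literature.NumberTheory.EllipticCurves.finite_point_of_hasCM_of_L_one_ne_zero`
(`ComplexMultiplication.lean`: *if `E/ℚ` has complex multiplication and `L(E, 1) ≠ 0` then `E(ℚ)`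
is finite* — Coates–Wiles, Invent. Math. 39 (1977), Thm. 1, read against Mordell–Weil and extended
from CM by `𝓞_K` to geometric CM; Silverman, *AEC*, App. C §16, Evidence 16.5.3).

After `ComplexMultiplicationHasCMLeavesProofs.lean` (five leaves) two further leaves are theorems:
`periodPair_hasCM_of_hasCM` (`ComplexMultiplicationPeriodLatticeCMProofs.lean`, with the analytic
`LatticeEndomorphismOfCurve.lean`) and `singularModuli_classNumberOne`
(`ComplexMultiplicationSingularModuliProofs.lean`: the rows `−67, −163` by kernel-checked
certificates of complex multiplication).  The trust base of the fact is now exactly the three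
printed theorems recorded as hypotheses of `finite_point_of_hasCM_of_L_one_ne_zero_of_three_leaves`:

1. `CoatesWiles1977_L_one_div_period_mem_prime` — the `𝔭`-adic core of Coates–Wiles 1977
   (§§2–6: the Grössencharacter, Lubin–Tate towers, elliptic units, explicit reciprocity laws;
   Thm. 29, Cor. 32, Thm. 34, Lemma 35, p. 250);
2. `irreducible_classPolynomial` — rationality and irreducibility of the class equation `H_D`
   (Cox, *Primes of the form x² + ny²*, Prop. 13.2 with Thm. 11.1: the First Main Theorem of
   complex multiplication);
3. `mem_classNumberOneDiscrs_of_classNumber_eq_one` — the class number one problem for imaginary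
   quadratic orders (Heegner 1952, Baker 1966, Stark 1967; Cox Thm. 7.30(ii)).

Everything else (Mordell–Weil, isogeny invariance of finiteness and of `L(E, s)` for the
isogenies that occur, the `ℚ`-isogenies to maximal CM, uniformization, `End(E) ≠ ℤ ⟹ End(Λ) ≠ ℤ`,
Gauss reduction, the thirteen singular moduli, the non-anomalous split primes and the closing norm
argument of Coates–Wiles p. 251) is proved in the tree.

## References

* J. Coates, A. Wiles, *On the conjecture of Birch and Swinnerton-Dyer*, Invent. Math. 39 (1977),
  223–251, Thm. 1 (p. 223) and §6 (pp. 250–251). [CoatesWiles1977]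
* J. H. Silverman, *The Arithmetic of Elliptic Curves*, 2nd ed. (2009), App. C §16, Evidence
  16.5.3; App. C §11, Examples 11.3.1–11.3.2; Thm. VI.5.3. [SilvermanAEC2009]
* D. A. Cox, *Primes of the form x² + ny²*, 2nd ed. (2013), Thm. 7.30, §12.C (12.20),
  §13.A Prop. 13.2. [Cox2013]
-/

noncomputable section

namespace Literature.NumberTheory.EllipticCurves

open Literature.NumberTheory.QuadraticFields.BinaryQuadraticForm

/-- **`j_mem_cmJInvariants_of_hasCM` from two named facts**: an elliptic curve over `ℚ` with
(geometric) complex multiplication has one of the thirteen rational CM `j`-invariants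
(Silverman, *AEC*, C.11.3.1–11.3.2), assuming only the class equation
(`irreducible_classPolynomial`, Cox Prop. 13.2) and Heegner–Baker–Stark for orders
(`mem_classNumberOneDiscrs_of_classNumber_eq_one`, Cox Thm. 7.30(ii)).
[cite: SilvermanAEC2009, App. C §11, Example 11.3.1–11.3.2] -/
theorem j_mem_cmJInvariants_of_hasCM_of_two_facts (hirr : irreducible_classPolynomial)
    (hh : mem_classNumberOneDiscrs_of_classNumber_eq_one) : j_mem_cmJInvariants_of_hasCM :=
  j_mem_cmJInvariants_of_hasCM_of_three_facts hirr hh singularModuli_classNumberOne_holds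

/-- **`finite_point_of_hasCM_of_L_one_ne_zero` from its three remaining leaves.**  For an
elliptic curve `E/ℚ` with (geometric) complex multiplication and `L(E, 1) ≠ 0`, the group `E(ℚ)`
is finite (Coates–Wiles 1977, Thm. 1; Silverman *AEC* C.16.5.3) — assuming exactly the
`𝔭`-divisibility core of Coates–Wiles (`h1`), the irreducibility of the class equation (`hirr`)
and Heegner–Baker–Stark for orders (`hh`).
[cite: CoatesWiles1977, Thm 1 (p. 223)] [cite: SilvermanAEC2009, App. C §16, Evidence C.16.5.3] -/
theorem finite_point_of_hasCM_of_L_one_ne_zero_of_three_leaves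
    (h1 : CoatesWiles1977_L_one_div_period_mem_prime) (hirr : irreducible_classPolynomial)
    (hh : mem_classNumberOneDiscrs_of_classNumber_eq_one) :
    finite_point_of_hasCM_of_L_one_ne_zero :=
  finite_point_of_hasCM_of_L_one_ne_zero_of_four_leaves h1 singularModuli_classNumberOne_holds
    hirr hh

/-- The BSD rank formula `r_an(E) = rank E(ℚ)` (`= 0`) in the CM analytic-rank-zero case
(`bsdRankFormula_of_hasCM_of_L_one_ne_zero`, bsd.S28) from the same three leaves.
[cite: CoatesWiles1977, Thm 1 (rank-zero consequence)] -/
theorem bsdRankFormula_of_hasCM_of_L_one_ne_zero_of_three_leaves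
    (h1 : CoatesWiles1977_L_one_div_period_mem_prime) (hirr : irreducible_classPolynomial)
    (hh : mem_classNumberOneDiscrs_of_classNumber_eq_one) :
    bsdRankFormula_of_hasCM_of_L_one_ne_zero :=
  bsdRankFormula_of_hasCM_of_L_one_ne_zero_of_finite_point
    (finite_point_of_hasCM_of_L_one_ne_zero_of_three_leaves h1 hirr hh)

end Literature.NumberTheory.EllipticCurves

end
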